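import Summits.QuantumFields.BalabanUV.Beta.WilsonFluctuationWard22Entry
import Summits.QuantumFields.BalabanUV.Beta.WilsonBiStencilWardZ

/-!
# `BalabanUV.Beta.WilsonFluctuationWard22Trace` — the fluctuation-LEG pure-gauge law of the colour-traced Wilson (2,2) table `wsym22 N` on every
# FINITE lattice: (E₂) at bond letters, TRACED OVER THE FLUCTUATION COLOUR (file (R2c) of the kernel route to the leg law of
# `wilsonW₂ d ((8N²)⁻¹ • wsym22 N)` and to the torus row `torus_a2_wilson`; D1 formalisation swarm seat `b2b-balaban-beta-d1-formalise-leaf-05`, gen 35)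

HONEST FRAMING (cell charter, verbatim): «discharging `BetaPertH` makes Bałaban's UV stability UNCONDITIONAL — a real
constructive-QFT result; it is NOT the continuum limit and NOT the Clay problem.»  HONEST DEPENDENCY (cell records, verbatim):
«continuum YM on T⁴ ⇐ BetaPertH ∧ nine spine estimates (0/9 proved); BetaPertH ⇐ (D1) ∧ (D4) ∧ CAP+tail; G-an2-4 gates asym, D1 and
NE2/3/4.»  DERIVED cell leaf: [folklore] finite-dimensional algebra over an arbitrary finite abelian lattice, no estimate, no limit, nothing
cited — every statement is kernel-proved here; no `[cite:]` tag, no `def`, no `def … : Prop`.  By itself this file instantiates NO binder of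
the β-function wall and NO row of the door.  NOT D1, NOT `BetaPertH`, NOT continuum, NOT Clay.  «not in print; our bookkeeping».
ABSOLUTE RULE (cell charter, verbatim): «No internally-minted statement may enter as a cited fact. Every hypothesis is either
kernel-proved in this package or a verbatim quotation of a PUBLISHED theorem with page reference. The manuscript(s) under audit are
NOT citable for their own disputed steps — they are the thing under adjudication; programme-internal (2001/route/tribunal) claims are
never citable.»

## What

(R2b) `WilsonFluctuationWard22Entry.flucWard22_letters` is (E₂) at bond letters with the letters `X` (test leg = gauge letter), `Y₁`, `Y₂` free.
Here the letters are Bałaban's (`𝔸 = Matrix (Fin N) (Fin N) ℂ`, an3's `Matrix.linftyOp*` instances via `open scoped Matrix.Norms.Operator`,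
`τ : C → Matrix (Fin N) (Fin N) ℂ` complete and tr-orthonormal (`ColourTrace`), trace `rntr`, letters `gen τ`): `X := gen τ a`, `Y₁ = Y₂ := gen τ c`,
and the identity is SUMMED OVER THE FLUCTUATION COLOUR `a` (the colour-blind one-loop contraction sees the (2,2) table only through this trace —
an3's `PlaquetteVertex2Trace.sum_K22_diag` convention that defines `w22` ∕ `wsym22`).  §1 the four colour traces: the `(2,2)` entries at fluctuation
colours `(0,0)` of the family `![gen τ a, gen τ c, gen τ c]` trace to `bondPairTab (w22 N)` (an3's `sum_cwordV_diag` ∕ `bondPairTab_w22_eq_sum`; the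
words see the family only through `t a`, `rfl`); the `(2,1)` number traces to `ℓ·2N²`, the `(2,0)` number to `−(ℓ₁ + ℓ₂)·2N²`, the `(1,1)` number to
`−ℓ·2N²` (leaf-09's `sum_rntr_conj₁`, `rntr_mul_br_br`, an3's `sum_rntr_seagull`).  §2 **`flucWard22_traced_table`** — for every finite lattice `Λ`
with frame `e`, `N ≠ 0`, profile `ℓ`, test leg `(x,α)`, background bonds `(u,κ)`, `(u′,κ′)`:
`Σ_{z,γ} bondPairTab e u′ κ′ u κ (wsym22 N) (x,α) (z,γ)·(ℓ z − ℓ(z+e_γ))`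
`  = 4N²·(ℓ(u+e_κ)·S₀A e u′ κ′ (x,α) (u,κ) + ℓ(u′+e_κ′)·S₀A e u κ (x,α) (u′,κ′)) + 2N²·[b₁ = b₂]·(ℓ(u+e_κ) + ℓ(u′+e_κ′))·Lc e κ u (x,α)`
`    − 2N²·([(x,α) = b₁]·ℓ(u+e_κ)·Lc e κ′ u′ (x,α) + [(x,α) = b₂]·ℓ(u′+e_κ′)·Lc e κ u (x,α))`
(leaf-09's `bondPairTab_fourTerm`, an3's `symTab_w22`); and at the site delta `ℓ = δ_y` **`flucWard22_traced_gaugeLeg`**: the pure-gauge FLUCTUATION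
`d(δ_y)` on the table's second leg — TIP of the other background bond against the antisymmetrised colourless (2,1) stencil `S₀A`, a same-bond contact
and a bond-equals-leg contact against the curl–curl coefficient `Lc`; the (2,2) twin of gan24-leaf-02's `GAN24.WilsonStencilGaugeLeg` and the
fluctuation-slot companion of leaf-09's `WilsonBiStencilWardZ.bgWard22_traced_div_wsym22`.
NOT HERE ((R3), (R4)): the transfer to `ℤ^{d+1}` (`wEntry₂`∕`wilsonW₂`, `wilsonA`, `curvAdj ∘ curv`), the colour-free `(8N²)⁻¹` form, the torus row.
Provenance: pub-balaban β sub-cell, D1 formalisation swarm, unit `b2b-balaban-beta-d1-formalise-leaf-05` gen 35, 2026-08-23 (v1); over (R2b) and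
leaf-09's ∕ an3's files named above BY NAME; no existing file touched.
-/

namespace Summit.QuantumFields.BalabanUV.Beta.WilsonFluctuationWard22Trace

open Finset
open scoped BigOperators Matrix
open Literature.MathematicalPhysics.QuantumFieldTheory.Balaban1983to89.Beta
open Literature.MathematicalPhysics.QuantumFieldTheory.Balaban1983to89.Beta.SpinTable (br)
open Literature.MathematicalPhysics.QuantumFieldTheory.Balaban1983to89.Beta.ColourTrace (Complete TrOrthonormal)
open Literature.MathematicalPhysics.QuantumFieldTheory.Balaban1983to89.Beta.PlaquetteVertex (rntr rntr_comm gen)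
open Literature.MathematicalPhysics.QuantumFieldTheory.Balaban1983to89.Beta.PlaquetteVertex2Trace (w22 sum_rntr_seagull)
open Literature.MathematicalPhysics.QuantumFieldTheory.Balaban1983to89.Beta.WilsonVertex2Kron (cwordV cmat stab kap wilsonVertex₂ wilsonVertex₂_apply
  bondPairTab sum_cwordV_diag bondPairTab_w22_eq_sum)
open Literature.MathematicalPhysics.QuantumFieldTheory.Balaban1983to89.Beta.WilsonVertex2Sym (wsym22 symTab_w22)
open Summit.QuantumFields.BalabanUV.Beta.WilsonReflectionFrame (Lc S₀A)
open Summit.QuantumFields.BalabanUV.Beta.WilsonBiStencilWardTrace (rntr_mul_br_br sum_rntr_conj₁ sum_siteDelta_profile)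
open Summit.QuantumFields.BalabanUV.Beta.WilsonBiStencilWardZ (bondPairTab_fourTerm)
open Summit.QuantumFields.BalabanUV.Beta.WilsonFluctuationWard22Entry (flucWard22_letters)

section Traces

open scoped Matrix.Norms.Operator

variable {N : ℕ} {C : Type*} [Fintype C] [DecidableEq C]
variable {Λ : Type*} [DecidableEq Λ] [AddCommGroup Λ] {D : Type*} [Fintype D] [DecidableEq D]

/-! ## §1 The four colour traces -/

/-- [folklore] **THE `(2,2)` ENTRIES AT THE FLUCTUATION COLOURS `(0,0)` OF THE FAMILY `![gen τ a, gen τ c, gen τ c]` TRACE TO `bondPairTab (w22 N)`**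
(background points at colours `1`, `2`; an3's `wilsonVertex₂_apply`, `sum_cwordV_diag`, `bondPairTab_w22_eq_sum`; the colour words see the family only through
`t 0 = gen τ a`). -/
theorem sum_wilsonVertex₂_fam3_diag {τ : C → Matrix (Fin N) (Fin N) ℂ} (hτ : Complete τ) (ho : TrOrthonormal τ) (hN : N ≠ 0) (c : C)
    (e : D → Λ) (i j : Fin 3) (hi : i = 1 ∨ i = 2) (hj : j = 1 ∨ j = 2)
    (u₁ : Λ) (κ₁ : D) (u₂ : Λ) (κ₂ : D) (x : Λ) (α : D) (z : Λ) (β : D) :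
    ∑ a, wilsonVertex₂ rntr ![gen τ a, gen τ c, gen τ c] e (u₁, (i, κ₁)) (u₂, (j, κ₂)) (x, ((0 : Fin 3), α)) (z, ((0 : Fin 3), β)) =
      bondPairTab e u₁ κ₁ u₂ κ₂ (w22 N) (x, α) (z, β) := by
  have hfam : ∀ (a : C) (w : Fin 9), cmat rntr ![gen τ a, gen τ c, gen τ c] w i j 0 0 = cwordV rntr (gen τ) (gen τ c) (gen τ c) a a w := by
    intro a w
    rcases hi with rfl | rfl <;> rcases hj with rfl | rfl <;> rfl
  simp only [wilsonVertex₂_apply, hfam]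
  rw [Finset.sum_comm]
  simp only [← Finset.sum_mul, sum_cwordV_diag hτ ho hN, if_true]
  rw [bondPairTab_w22_eq_sum, Matrix.sum_apply]
  exact Finset.sum_congr rfl fun w _ => by rw [Matrix.smul_apply, smul_eq_mul]

/-- [folklore] an indicator letter on the right of a word pulls out of the trace as a real indicator. -/
theorem rntr_mul_ite (M A : Matrix (Fin N) (Fin N) ℂ) (P : Prop) [Decidable P] :
    rntr (M * (if P then A else 0)) = (if P then (1 : ℝ) else 0) * rntr (M * A) := by
  split_ifs <;> simp

/-- [folklore] an indicator letter on the left of a word pulls out of the trace as a real indicator. -/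
theorem rntr_ite_mul (M A : Matrix (Fin N) (Fin N) ℂ) (P : Prop) [Decidable P] :
    rntr ((if P then A else 0) * M) = (if P then (1 : ℝ) else 0) * rntr (A * M) := by
  split_ifs <;> simp

/-- [folklore] **THE `(2,1)` NUMBER**: `Σ_a rntr(t_c·(t_a·K − K·t_a)) = ℓ·2N²` for `K = ℓ • (t_a t_c − t_c t_a)` (leaf-09's `sum_rntr_conj₁`). -/
theorem sum_rntr_twoOne {τ : C → Matrix (Fin N) (Fin N) ℂ} (hτ : Complete τ) (ho : TrOrthonormal τ) (hN : N ≠ 0) (c : C) (ell : ℝ) :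
    ∑ a, rntr (gen τ c * (gen τ a * (ell • (gen τ a * gen τ c - gen τ c * gen τ a)) - (ell • (gen τ a * gen τ c - gen τ c * gen τ a)) * gen τ a)) =
      ell * (2 * (N : ℝ) ^ 2) := by
  classical
  have h := sum_rntr_conj₁ hτ ho hN c c
  rw [if_pos rfl] at h
  have e : ∀ a, rntr (gen τ c * (gen τ a * (ell • (gen τ a * gen τ c - gen τ c * gen τ a)) - (ell • (gen τ a * gen τ c - gen τ c * gen τ a)) * gen τ a)) =
      -(ell * rntr (gen τ c * br (gen τ a) (gen τ c * gen τ a - gen τ a * gen τ c))) := by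
    intro a
    rw [mul_smul_comm, smul_mul_assoc, ← smul_sub, mul_smul_comm, map_smul, smul_eq_mul, ← mul_neg, ← map_neg]
    congr 2
    simp only [br]
    noncomm_ring
  simp only [e, Finset.sum_neg_distrib, ← Finset.mul_sum, h]
  ring

/-- [folklore] **THE `(2,0)` NUMBER**: `Σ_a rntr(t_a·(t_c·K₂ − K₂·t_c + (t_c·K₁ − K₁·t_c))) = −(ℓ₂ + ℓ₁)·2N²`, `K_i = ℓ_i • (t_a t_c − t_c t_a)` (cyclicity
`rntr_mul_br_br` and an3's seagull sum `sum_rntr_seagull`). -/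
theorem sum_rntr_twoZero {τ : C → Matrix (Fin N) (Fin N) ℂ} (hτ : Complete τ) (ho : TrOrthonormal τ) (hN : N ≠ 0) (c : C) (ell₁ ell₂ : ℝ) :
    ∑ a, rntr (gen τ a * (gen τ c * (ell₂ • (gen τ a * gen τ c - gen τ c * gen τ a)) - (ell₂ • (gen τ a * gen τ c - gen τ c * gen τ a)) * gen τ c
        + (gen τ c * (ell₁ • (gen τ a * gen τ c - gen τ c * gen τ a)) - (ell₁ • (gen τ a * gen τ c - gen τ c * gen τ a)) * gen τ c))) =
      -((ell₂ + ell₁) * (2 * (N : ℝ) ^ 2)) := by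
  classical
  have h := sum_rntr_seagull hτ ho hN c c
  rw [if_pos rfl] at h
  have e : ∀ a, rntr (gen τ a * (gen τ c * (ell₂ • (gen τ a * gen τ c - gen τ c * gen τ a)) - (ell₂ • (gen τ a * gen τ c - gen τ c * gen τ a)) * gen τ c
        + (gen τ c * (ell₁ • (gen τ a * gen τ c - gen τ c * gen τ a)) - (ell₁ • (gen τ a * gen τ c - gen τ c * gen τ a)) * gen τ c))) =
      (ell₂ + ell₁) * rntr (br (gen τ c) (gen τ a) * br (gen τ c) (gen τ a)) := by
    intro a
    have hc : gen τ a * (gen τ c * (ell₂ • (gen τ a * gen τ c - gen τ c * gen τ a)) - (ell₂ • (gen τ a * gen τ c - gen τ c * gen τ a)) * gen τ c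
        + (gen τ c * (ell₁ • (gen τ a * gen τ c - gen τ c * gen τ a)) - (ell₁ • (gen τ a * gen τ c - gen τ c * gen τ a)) * gen τ c)) =
        (ell₂ + ell₁) • (gen τ a * br (gen τ c) (br (gen τ a) (gen τ c))) := by
      simp only [br, mul_smul_comm, smul_mul_assoc, ← smul_sub, add_smul, mul_add]
    rw [hc, map_smul, smul_eq_mul, rntr_mul_br_br]
    congr 2
    simp only [br]
    noncomm_ring
  simp only [e, ← Finset.mul_sum, h]
  ring

/-- [folklore] **THE `(1,1)` NUMBER**: `Σ_a rntr((K·t_a − t_a·K)·t_c) = −ℓ·2N²`, `K = ℓ • (t_a t_c − t_c t_a)` (cyclicity and leaf-09's `sum_rntr_conj₁`). -/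
theorem sum_rntr_oneOne {τ : C → Matrix (Fin N) (Fin N) ℂ} (hτ : Complete τ) (ho : TrOrthonormal τ) (hN : N ≠ 0) (c : C) (ell : ℝ) :
    ∑ a, rntr (((ell • (gen τ a * gen τ c - gen τ c * gen τ a)) * gen τ a - gen τ a * (ell • (gen τ a * gen τ c - gen τ c * gen τ a))) * gen τ c) =
      -(ell * (2 * (N : ℝ) ^ 2)) := by
  classical
  have h := sum_rntr_conj₁ hτ ho hN c c
  rw [if_pos rfl] at h
  have e : ∀ a, rntr (((ell • (gen τ a * gen τ c - gen τ c * gen τ a)) * gen τ a - gen τ a * (ell • (gen τ a * gen τ c - gen τ c * gen τ a))) * gen τ c) =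
      ell * rntr (gen τ c * br (gen τ a) (gen τ c * gen τ a - gen τ a * gen τ c)) := by
    intro a
    rw [rntr_comm, mul_smul_comm, smul_mul_assoc, ← smul_sub, mul_smul_comm, map_smul, smul_eq_mul]
    congr 2
    simp only [br]
    noncomm_ring
  simp only [e, ← Finset.mul_sum, h]
  ring

/-! ## §2 The traced table law -/

variable [Fintype Λ]

/-- [folklore] **THE FLUCTUATION-LEG PURE-GAUGE LAW OF THE COLOUR-TRACED WILSON (2,2) TABLE `wsym22 N` ON A FINITE LATTICE** (see the module docstring):
`Σ_{z,γ} bondPairTab e u′ κ′ u κ (wsym22 N) (x,α) (z,γ)·(ℓ z − ℓ(z+e_γ)) = 4N²·(ℓ(u+e_κ)·S₀A e u′ κ′ (x,α) (u,κ) + ℓ(u′+e_κ′)·S₀A e u κ (x,α) (u′,κ′))`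
`+ 2N²·[u = u′ ∧ κ = κ′]·(ℓ(u+e_κ) + ℓ(u′+e_κ′))·Lc e κ u (x,α) − 2N²·([x = u ∧ α = κ]·ℓ(u+e_κ)·Lc e κ′ u′ (x,α) + [x = u′ ∧ α = κ′]·ℓ(u′+e_κ′)·Lc e κ u (x,α))`
(indicators as the reals `[P] = if P then 1 else 0`). -/
theorem flucWard22_traced_table {τ : C → Matrix (Fin N) (Fin N) ℂ} (hτ : Complete τ) (ho : TrOrthonormal τ) (hN : N ≠ 0) (c : C)
    (e : D → Λ) (ell : Λ → ℝ) (x : Λ) (α : D) (u : Λ) (κ : D) (u' : Λ) (κ' : D) :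
    ∑ z : Λ, ∑ γ : D, bondPairTab e u' κ' u κ (wsym22 N) (x, α) (z, γ) * (ell z - ell (z + e γ)) =
      4 * (N : ℝ) ^ 2 * (ell (u + e κ) * S₀A e u' κ' (x, α) (u, κ) + ell (u' + e κ') * S₀A e u κ (x, α) (u', κ'))
      + 2 * (N : ℝ) ^ 2 * ((if u = u' ∧ κ = κ' then (1 : ℝ) else 0) * (ell (u + e κ) + ell (u' + e κ')) * Lc e κ u (x, α))
      - 2 * (N : ℝ) ^ 2 * ((if x = u ∧ α = κ then (1 : ℝ) else 0) * ell (u + e κ) * Lc e κ' u' (x, α)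
          + (if x = u' ∧ α = κ' then (1 : ℝ) else 0) * ell (u' + e κ') * Lc e κ u (x, α)) := by
  classical
  -- the letter law at `X := gen τ a`, `Y₁ = Y₂ := gen τ c`, indicators pulled out of the traces
  have h : ∀ a : C, _ := fun a => by
    have h0 := flucWard22_letters rntr rntr_comm e (gen τ a) (gen τ c) (gen τ c) ell x α u κ u' κ'
    rw [rntr_mul_ite, rntr_ite_mul, rntr_ite_mul] at h0
    exact h0
  -- the (2,2) traces
  have t22a := fun (p q : Λ × D) => sum_wilsonVertex₂_fam3_diag hτ ho hN c e 1 2 (Or.inl rfl) (Or.inr rfl) u κ u' κ' p.1 p.2 q.1 q.2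
  have t22b := fun (p q : Λ × D) => sum_wilsonVertex₂_fam3_diag hτ ho hN c e 2 1 (Or.inr rfl) (Or.inl rfl) u' κ' u κ p.1 p.2 q.1 q.2
  have t22 : ∑ a, (∑ z : Λ, ∑ γ : D,
        ((wilsonVertex₂ rntr ![gen τ a, gen τ c, gen τ c] e (u, ((1 : Fin 3), κ)) (u', ((2 : Fin 3), κ'))
              + wilsonVertex₂ rntr ![gen τ a, gen τ c, gen τ c] e (u', ((2 : Fin 3), κ')) (u, ((1 : Fin 3), κ))) (x, ((0 : Fin 3), α)) (z, ((0 : Fin 3), γ))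
          + (wilsonVertex₂ rntr ![gen τ a, gen τ c, gen τ c] e (u, ((1 : Fin 3), κ)) (u', ((2 : Fin 3), κ'))
              + wilsonVertex₂ rntr ![gen τ a, gen τ c, gen τ c] e (u', ((2 : Fin 3), κ')) (u, ((1 : Fin 3), κ))) (z, ((0 : Fin 3), γ)) (x, ((0 : Fin 3), α)))
          * (ell z - ell (z + e γ))) =
      ∑ z : Λ, ∑ γ : D, bondPairTab e u' κ' u κ (wsym22 N) (x, α) (z, γ) * (ell z - ell (z + e γ)) := by
    rw [Finset.sum_comm]
    refine Finset.sum_congr rfl fun z _ => ?_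
    rw [Finset.sum_comm]
    refine Finset.sum_congr rfl fun γ _ => ?_
    rw [← Finset.sum_mul]
    congr 1
    simp only [Matrix.add_apply, Finset.sum_add_distrib]
    have a1 := t22a (x, α) (z, γ)
    have a2 := t22b (x, α) (z, γ)
    have a3 := t22a (z, γ) (x, α)
    have a4 := t22b (z, γ) (x, α)
    dsimp only at a1 a2 a3 a4
    rw [a1, a2, a3, a4, ← symTab_w22, ← bondPairTab_fourTerm e u κ u' κ' (w22 N) (x, α) (z, γ)]
    ring
  have t21 := sum_rntr_twoOne hτ ho hN c (ell (u + e κ))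
  have t21' := sum_rntr_twoOne hτ ho hN c (ell (u' + e κ'))
  have t20 := sum_rntr_twoZero hτ ho hN c (ell (u + e κ)) (ell (u' + e κ'))
  have t11 := sum_rntr_oneOne hτ ho hN c (ell (u + e κ))
  have t11' := sum_rntr_oneOne hτ ho hN c (ell (u' + e κ'))
  -- sum the letter law over the fluctuation colour
  have total := Finset.sum_congr rfl fun (a : C) (_ : a ∈ (Finset.univ : Finset C)) => h a
  simp only [Finset.sum_add_distrib, Finset.sum_sub_distrib, ← Finset.mul_sum, ← Finset.sum_mul, t22, t21, t21', t20, t11, t11'] at total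
  linear_combination (1 / 4 : ℝ) * total

/-- [folklore] **THE PURE-GAUGE FLUCTUATION `d(δ_y)` ON THE SECOND LEG OF THE COLOUR-TRACED WILSON (2,2) TABLE, ON A FINITE LATTICE** (`flucWard22_traced_table` at
the site delta `ℓ = δ_y`, leaf-09's `sum_siteDelta_profile`):
`Σ_γ (BPT e u′κ′ uκ wsym22 (x,α) (y,γ) − BPT … (x,α) (y − e_γ, γ)) = 4N²·([u+e_κ = y]·S₀A e u′ κ′ (x,α) (u,κ) + [u′+e_κ′ = y]·S₀A e u κ (x,α) (u′,κ′))`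
`+ 2N²·[b₁ = b₂]·([u+e_κ = y] + [u′+e_κ′ = y])·Lc e κ u (x,α) − 2N²·([(x,α) = b₁]·[u+e_κ = y]·Lc e κ′ u′ (x,α) + [(x,α) = b₂]·[u′+e_κ′ = y]·Lc e κ u (x,α))`
— the TIP rule on the other background bond against an3's antisymmetrised colourless (2,1) stencil, a same-bond contact and a bond-equals-leg contact against
leaf-05-g2's curl–curl coefficient. -/
theorem flucWard22_traced_gaugeLeg {τ : C → Matrix (Fin N) (Fin N) ℂ} (hτ : Complete τ) (ho : TrOrthonormal τ) (hN : N ≠ 0) (c : C)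
    (e : D → Λ) (y : Λ) (x : Λ) (α : D) (u : Λ) (κ : D) (u' : Λ) (κ' : D) :
    ∑ γ : D, (bondPairTab e u' κ' u κ (wsym22 N) (x, α) (y, γ) - bondPairTab e u' κ' u κ (wsym22 N) (x, α) (y - e γ, γ)) =
      4 * (N : ℝ) ^ 2 * ((if u + e κ = y then (1 : ℝ) else 0) * S₀A e u' κ' (x, α) (u, κ)
          + (if u' + e κ' = y then (1 : ℝ) else 0) * S₀A e u κ (x, α) (u', κ'))
      + 2 * (N : ℝ) ^ 2 * ((if u = u' ∧ κ = κ' then (1 : ℝ) else 0)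
          * ((if u + e κ = y then (1 : ℝ) else 0) + (if u' + e κ' = y then (1 : ℝ) else 0)) * Lc e κ u (x, α))
      - 2 * (N : ℝ) ^ 2 * ((if x = u ∧ α = κ then (1 : ℝ) else 0) * (if u + e κ = y then (1 : ℝ) else 0) * Lc e κ' u' (x, α)
          + (if x = u' ∧ α = κ' then (1 : ℝ) else 0) * (if u' + e κ' = y then (1 : ℝ) else 0) * Lc e κ u (x, α)) := by
  classical
  have h := flucWard22_traced_table hτ ho hN c e (fun y' => if y' = y then (1 : ℝ) else 0) x α u κ u' κ'
  have hl : ∑ z : Λ, ∑ γ : D, bondPairTab e u' κ' u κ (wsym22 N) (x, α) (z, γ) * ((if z = y then (1 : ℝ) else 0) - (if z + e γ = y then 1 else 0)) =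
      ∑ γ : D, (bondPairTab e u' κ' u κ (wsym22 N) (x, α) (y, γ) - bondPairTab e u' κ' u κ (wsym22 N) (x, α) (y - e γ, γ)) := by
    rw [← sum_siteDelta_profile e y (fun z γ => bondPairTab e u' κ' u κ (wsym22 N) (x, α) (z, γ))]
    exact Finset.sum_congr rfl fun z _ => Finset.sum_congr rfl fun γ _ => mul_comm _ _
  rw [hl] at h
  exact h

end Traces

end Summit.QuantumFields.BalabanUV.Beta.WilsonFluctuationWard22Trace
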